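import Summits.QuantumFields.YangMills.Theses.ContractibleFibre
import Literature.MathematicalPhysics.QuantumLattice.LatticeGaugeDLRGibbsProofs
import Summits.QuantumFields.YangMills.Theorems.ContractibleFibreFibreToTorusStubTubeLimitState

/-!
# Line `uniqueness` for crux `FibreToTorus` (stmt-QuantumFields-16244) — `Lines/uniqueness.lean`

Crux-strategist seat `planner-cstrat-stmt-QuantumFields-16244-b1-0` (2026-08-17), route
`route-QuantumFields-ContractibleFibre`, rank-4 crux; ALT line to `Lines/birth.lean` (T → P → V).
Namespace `Summit.QuantumFields.YangMills.Cruxes.FibreToTorus.Uniqueness`; imports the route file and the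
proof file `LatticeGaugeDLRGibbsProofs` (periodic limit points are DLR states — a LANDED theorem used in the glue).

## The cut: thermodynamic limit → DLR UNIQUENESS ON GAUGE INVARIANTS → finite-size passage

The crux (FREE TUBES ⇒ SYMMETRIC TORUS) hides ONE weak-coupling input that its hypothesis does not supply:
the identification of the free-tube phase with the periodic phase (refuter objection F3; the route's own
why-might-fail).  `birth` isolates it as (P) "SOME exponentially clustering DLR state exists at all large β ⇒
EVERY periodic limit point clusters at SOME rate" — an implication whose antecedent is nearly idle (its consequent
is the infinite-volume lattice gap outright, with a fresh rate).  This line cuts at the CLASSICAL statement instead: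

* `stub_tubeLimitState` (T) — verbatim `birth`'s (T): the `M`-uniform free-tube family at `(β, m)` ⇒ a DLR state
  `μ ∈ ymGibbsMeasures r.ρ β` on `ℤ⁴` clustering in time at the SAME rate `m` on gauge-invariant local observables.
  Size M–L, group-blind, provable now (compactness + equicontinuous DLR densities; Georgii Thm 4.17 shape).
* `stub_gaugeInvariantUniqueness` (U) — NEW: for every compact simple `G` and faithful `r` there is `β_u` such that
  at every `β ≥ β_u` ANY two DLR states of the Wilson specification agree on every gauge-invariant local observable
  (`YMSpecies`).  This is uniqueness of the infinite-volume limit at WEAK coupling restricted to the gauge-invariant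
  algebra (Seiler LNP 159 Ch. 2–3, open; proved at STRONG coupling by the cluster expansion, Osterwalder–Seiler 1978
  Thm 3.5 = tree fact `HasUniqueInfiniteVolumeLimit` corner).  It mentions no clustering, no torus, no rate: it is
  neither the crux nor the summit in costume, and it is NOT implied by the summit's lattice leg either — it is the
  honest, shareable price of a free-boundary presentation (the same input is owed by every route whose finite volumes
  are not the symmetric tori: free slabs, hyperbolic balls, open-boundary anchors).
* `stub_torusFiniteSize` (V) — verbatim `birth`'s (V): periodic limit points cluster at one rate with constants
  uniform over the limit points ⇒ the crux's conclusion (`S`-uniform clustering on `(2S+1)⁴`, `n ≤ S`).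
* `FibreToTorus_of : (T) → (U) → (V) → FibreToTorus` — PROVED below without `sorry`: at `β ≥ max β₁ β_u`, (T) turns the
  tube family into a clustering DLR state `μ` at the TUBE rate `m(β)`; every periodic limit point `ν` is DLR (landed
  theorem `mem_ymGibbsMeasures_of_mem_infiniteVolumeLimitPoints_holds`, with `T2Space`/`SecondCountableTopology G`
  obtained from the faithful representation `r`); by (U) `ν` and `μ` agree on `A`, on `τₙB` and on `A·τₙB` (the shifted
  and product species are built here: `shiftObs`, `prodObs`), so `ν` clusters at rate `m(β)` with `μ`'s constants;
  (V) at threshold `max β₁ β_u` is the crux's conclusion.  In this cut the crux hypothesis is LOAD-BEARING: the tube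
  rate is the torus rate (up to (V)), whereas in `birth` the rate is re-chosen by (P).

What this line does NOT claim: a technique for (U) or (V) at weak coupling — see `STRATEGY-CENSUS.md` in this crux
directory (transfer / strengthen / decomposition / negation): both are open, (U) independent of the summit, (V) the
finite-size passage every infinite-volume-first route owes.  The line is registered so that (i) the lead builds (T)
(shared with `birth`), (ii) the remaining content is typed as two NAMED statements a tenure planner can file as items
(`route edit --split FibreToTorus`, children = the three statements below, glue = `FibreToTorus_of`).

## Disproof used / junk audit

No `Disproof.lean` exists for this crux (crux dir has only `Lines/birth.*`); `ledger negatives --problem QuantumFields`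
has no DLR / uniqueness / clustering statement.  By hand: (U) is not vacuous (`ymGibbsMeasures` is non-empty at every β:
periodic limit points exist, `infiniteVolumeLimitPoints_nonempty_holds`, and are DLR) and not trivially false (the
zero measure is not a Gibbs measure: `IsGibbsMeasure` carries `IsProbabilityMeasure`; gauge copies `g·μ` of a DLR
state agree with `μ` on gauge invariants, which is why (U) is restricted to `YMSpecies`); bulk first-order points of
exotic `(G, r)` (Bhanot–Creutz lines) sit at `β = O(1)` and are absorbed by `∃ β_u`.  β = 0: (U) holds there trivially
(product Haar is the unique DLR state), immaterial since `β_u` is existential.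
-/

noncomputable section

namespace Summit.QuantumFields.YangMills.Cruxes.FibreToTorus.Uniqueness

open scoped BigOperators Topology Manifold Classical MeasureTheory ProbabilityTheory Matrix InnerProductSpace ComplexConjugate ContinuousMap
open Filter Set Function TopologicalSpace MeasureTheory
open Literature.MathematicalPhysics.QuantumFieldTheory
open Literature.Probability.LatticeModels (Site)
open Literature.MathematicalPhysics.QuantumLattice (LGConfig ZdEdge configShift configShift_apply gaugeTransformZd
  IsZdGaugeInvariant IsCylinder LocalGaugeObservable ymGibbsMeasures infiniteVolumeLimitPoints
  mem_ymGibbsMeasures_of_mem_infiniteVolumeLimitPoints_holds)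

/-! ## Species algebra used by the glue: shifted and product gauge-invariant local observables -/

section SpeciesAlgebra

variable {G : Type} [Group G] [MeasurableSpace G]

/-- The translate `U ↦ B(θ_v U)` of a gauge-invariant local observable (`θ_v = configShift v`) is again one:
support shifted by `-v`, gauge invariance by shifting the gauge transformation, measurability through the
measurable equivalence `configShift v`. [folklore] -/
def shiftObs (B : LocalGaugeObservable 4 G) (v : Site 4) : LocalGaugeObservable 4 G where
  F := fun U => B.F (configShift v U)
  supp := B.supp.image fun e => (e.1 - v, e.2)
  isCylinder := by
    intro U V h
    refine B.isCylinder fun e he => ?_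
    simp only [configShift_apply]
    exact h (e.1 - v, e.2) (Finset.mem_coe.2 (Finset.mem_image_of_mem (fun e : Literature.MathematicalPhysics.QuantumLattice.ZdEdge 4 => (e.1 - v, e.2))
      (Finset.mem_coe.1 he)))
  gaugeInvariant := by
    intro g U
    have hshift : configShift v (gaugeTransformZd g U) =
        gaugeTransformZd (fun x => g (x - v)) (configShift v U) := by
      funext e
      simp only [configShift_apply, gaugeTransformZd, sub_add_eq_add_sub]
    show B.F (configShift v (gaugeTransformZd g U)) = B.F (configShift v U)
    rw [hshift, B.gaugeInvariant]
  bounded := by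
    obtain ⟨C, hC⟩ := B.bounded
    exact ⟨C, fun U => hC _⟩
  measurable := B.measurable.comp (configShift v).measurable

/-- The product of two gauge-invariant local observables is one. [folklore] -/
def prodObs (A B : LocalGaugeObservable 4 G) : LocalGaugeObservable 4 G where
  F := fun U => A.F U * B.F U
  supp := A.supp ∪ B.supp
  isCylinder := by
    intro U V h
    show A.F U * B.F U = A.F V * B.F V
    rw [A.isCylinder fun e he => h e (by simp [Finset.mem_coe.1 he]),
      B.isCylinder fun e he => h e (by simp [Finset.mem_coe.1 he])]
  gaugeInvariant := by
    intro g U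
    show A.F (gaugeTransformZd g U) * B.F (gaugeTransformZd g U) = A.F U * B.F U
    rw [A.gaugeInvariant, B.gaugeInvariant]
  bounded := by
    obtain ⟨a, ha⟩ := A.bounded
    obtain ⟨b, hb⟩ := B.bounded
    refine ⟨a * b, fun U => ?_⟩
    rw [abs_mul]
    exact mul_le_mul (ha U) (hb U) (abs_nonneg _) ((abs_nonneg _).trans (ha U))
  measurable := A.measurable.mul B.measurable

@[simp] theorem shiftObs_F (B : LocalGaugeObservable 4 G) (v : Site 4) (U : LGConfig 4 G) :
    (shiftObs B v).F U = B.F (configShift v U) := rfl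

@[simp] theorem prodObs_F (A B : LocalGaugeObservable 4 G) (U : LGConfig 4 G) :
    (prodObs A B).F U = A.F U * B.F U := rfl

end SpeciesAlgebra

/-! ## The three stub STATEMENTS (named `Prop`s; the registered stubs below repeat them verbatim) -/

/-- **(T) Thermodynamic limit of the free tubes — statement** (verbatim `birth`'s `TubeThermodynamicLimit`). For
every compact simple `G`, faithful unitary `r`, coupling `β` and rate `m > 0`: IF the free tubes `(ℤ/L)²×{0..M}²` of
EVERY fibre width `M` cluster in time at rate `m` with slab-width constants `C(w)` UNIFORM in `M` on all
`L ≥ L_min(M, w)` (the crux's inline predicate `Tube`), THEN some DLR state `μ ∈ ymGibbsMeasures r.ρ β` on `ℤ⁴` clusters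
in Euclidean time at the SAME rate `m` on all gauge-invariant local observables. -/
def TubeLimitState : Prop :=
  ∀ (G : Type) [Group G] [TopologicalSpace G] [IsTopologicalGroup G] [CompactSpace G]
    [MeasurableSpace G] [BorelSpace G], IsCompactSimpleLieGroup G → ∀ r : LatticeRep G,
    let Tube := fun (M : ℕ) (β m C : ℝ) (w Lmin : ℕ) => ∀ (L : ℕ) [NeZero L], Lmin ≤ L →
      let St := ZMod L × ZMod L × Fin (M + 1) × Fin (M + 1);
      let Cfg := St × Fin 4 → G;
      let ν : MeasureTheory.Measure Cfg := MeasureTheory.Measure.pi fun _ => haarProbability G;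
      let sh : St → Fin 4 → St := fun x μ => ![(x.1 + 1, x.2.1, x.2.2.1, x.2.2.2), (x.1, x.2.1 + 1, x.2.2.1, x.2.2.2), (x.1, x.2.1, x.2.2.1 + 1, x.2.2.2), (x.1, x.2.1, x.2.2.1, x.2.2.2 + 1)] μ;
      let ins : St → Fin 4 → Fin 4 → ℝ := fun x μ κ => if ((μ = 2 ∨ κ = 2) → (x.2.2.1 : ℕ) < M) ∧ ((μ = 3 ∨ κ = 3) → (x.2.2.2 : ℕ) < M) then 1 else 0;
      let pl : Cfg → St → Fin 4 → Fin 4 → G := fun U x μ κ => U (x, μ) * U (sh x μ, κ) * (U (sh x κ, μ))⁻¹ * (U (x, κ))⁻¹;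
      let act : Cfg → ℝ := fun U => β * ∑ x : St, ∑ q : {q : Fin 4 × Fin 4 // q.1 < q.2}, ins x q.1.1 q.1.2 * (r.ρ (pl U x q.1.1 q.1.2)).trace.re;
      let wgt : Cfg → ℝ := fun U => Real.exp (act U);
      let Ex : (Cfg → ℝ) → ℝ := fun F => (∫ U, F U * wgt U ∂ν) / (∫ U, wgt U ∂ν);
      let σ : ℕ → Cfg → Cfg := fun n U p => U ((p.1.1 + n, p.1.2), p.2);
      ∀ c : ZMod L,
      let Loc := fun F : Cfg → ℝ => Measurable F ∧ (∀ U, |F U| ≤ 1) ∧ ∀ U U', (∀ p : St × Fin 4, (p.1.1 - c).val ≤ w → U p = U' p) → F U = F U';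
      ∀ F₁ F₂ : Cfg → ℝ, Loc F₁ → Loc F₂ → ∀ n : ℕ, 2 * n < L → |Ex (fun U => F₁ U * F₂ (σ n U)) - Ex F₁ * Ex (fun U => F₂ (σ n U))| ≤ C * Real.exp (-(m * n));
    ∀ (β m : ℝ), 0 < m → (∀ w : ℕ, ∃ C : ℝ, ∀ M : ℕ, ∃ Lmin : ℕ, Tube M β m C w Lmin) →
      ∃ μ : MeasureTheory.Measure (LGConfig 4 G), μ ∈ ymGibbsMeasures (d := 4) r.ρ β ∧
        ∀ A B : YMSpecies G, ∃ C : ℝ, ∀ n : ℕ,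
          |(∫ U, A.F U * B.F (configShift (-Pi.single 0 (n : ℤ)) U) ∂μ) -
              (∫ U, A.F U ∂μ) * (∫ U, B.F (configShift (-Pi.single 0 (n : ℤ)) U) ∂μ)| ≤
            C * Real.exp (-(m * n))

/-- **(U) DLR uniqueness on gauge invariants at weak coupling — statement (NEW).** For every compact simple `G`
and faithful unitary `r` there is `β_u` such that at every `β ≥ β_u` any two infinite-volume Gibbs (DLR) states of
the Wilson specification `ymSpecification r.ρ β` on `ℤ⁴` have the same expectation of every bounded measurable
gauge-invariant cylinder observable (`YMSpecies G`).  Uniqueness of the infinite-volume limit at weak coupling on the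
gauge-invariant algebra: open (Seiler LNP 159 Ch. 2–3; Chatterjee arXiv:1803.01950 §2, §6); the strong-coupling
analogue is Osterwalder–Seiler 1978 Thm 3.5. -/
def GaugeInvariantUniqueness : Prop :=
  ∀ (G : Type) [Group G] [TopologicalSpace G] [IsTopologicalGroup G] [CompactSpace G]
    [MeasurableSpace G] [BorelSpace G], IsCompactSimpleLieGroup G → ∀ r : LatticeRep G,
    ∃ βu : ℝ, ∀ β : ℝ, βu ≤ β → ∀ μ ν : MeasureTheory.Measure (LGConfig 4 G),
      μ ∈ ymGibbsMeasures (d := 4) r.ρ β → ν ∈ ymGibbsMeasures (d := 4) r.ρ β →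
        ∀ A : YMSpecies G, ∫ U, A.F U ∂μ = ∫ U, A.F U ∂ν

/-- **(V) Finite-size passage: infinite volume ⇒ symmetric torus with `S`-uniform constants — statement**
(verbatim `birth`'s `VacuumDominance`). For every compact simple `G`, faithful unitary `r` and threshold `β₃`: IF at
every `β ≥ β₃` one rate `m > 0` clusters every periodic infinite-volume limit point on gauge-invariant local
observables with constants uniform over the limit points, THEN the crux's conclusion holds for `r` (the
`UniformLatticeGap` body). -/
def TorusFiniteSize : Prop :=
  ∀ (G : Type) [Group G] [TopologicalSpace G] [IsTopologicalGroup G] [CompactSpace G]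
    [MeasurableSpace G] [BorelSpace G], IsCompactSimpleLieGroup G → ∀ (r : LatticeRep G) (β₃ : ℝ),
    (∀ β : ℝ, β₃ ≤ β → ∃ m : ℝ, 0 < m ∧
      ∀ A B : YMSpecies G, ∃ C : ℝ, ∀ μ : MeasureTheory.Measure (LGConfig 4 G),
        μ ∈ infiniteVolumeLimitPoints (d := 4) r.ρ β → ∀ n : ℕ,
          |(∫ U, A.F U * B.F (configShift (-Pi.single 0 (n : ℤ)) U) ∂μ) -
              (∫ U, A.F U ∂μ) * (∫ U, B.F (configShift (-Pi.single 0 (n : ℤ)) U) ∂μ)| ≤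
            C * Real.exp (-(m * n))) →
    ∃ β₀ : ℝ, ∀ β : ℝ, β₀ ≤ β → ∃ m : ℝ, 0 < m ∧ ∃ S₁ : ℕ, ∀ A B : YMSpecies G, ∃ C : ℝ,
      ∀ S n : ℕ, S₁ ≤ S → n ≤ S →
        |latticeConnectedCorr r.ρ β (2 * S + 1) A.F B.F n| ≤ C * Real.exp (-(m * n))

/-! ## The three REGISTERED STUBS (the ONLY `sorry`s of this file; signatures = the statements above, verbatim) -/

/-- Registered stub `stub_tubeLimitState` : the statement `TubeLimitState` written out (a genuine lemma of the line;
same statement as `birth`'s `stub_tubeThermodynamicLimit` — one proof closes both). CLOSED 2026-08-17 (p159851). -/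
theorem stub_tubeLimitState :
    ∀ (G : Type) [Group G] [TopologicalSpace G] [IsTopologicalGroup G] [CompactSpace G]
      [MeasurableSpace G] [BorelSpace G], IsCompactSimpleLieGroup G → ∀ r : LatticeRep G,
      let Tube := fun (M : ℕ) (β m C : ℝ) (w Lmin : ℕ) => ∀ (L : ℕ) [NeZero L], Lmin ≤ L →
        let St := ZMod L × ZMod L × Fin (M + 1) × Fin (M + 1);
        let Cfg := St × Fin 4 → G;
        let ν : MeasureTheory.Measure Cfg := MeasureTheory.Measure.pi fun _ => haarProbability G;
        let sh : St → Fin 4 → St := fun x μ => ![(x.1 + 1, x.2.1, x.2.2.1, x.2.2.2), (x.1, x.2.1 + 1, x.2.2.1, x.2.2.2), (x.1, x.2.1, x.2.2.1 + 1, x.2.2.2), (x.1, x.2.1, x.2.2.1, x.2.2.2 + 1)] μ;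
        let ins : St → Fin 4 → Fin 4 → ℝ := fun x μ κ => if ((μ = 2 ∨ κ = 2) → (x.2.2.1 : ℕ) < M) ∧ ((μ = 3 ∨ κ = 3) → (x.2.2.2 : ℕ) < M) then 1 else 0;
        let pl : Cfg → St → Fin 4 → Fin 4 → G := fun U x μ κ => U (x, μ) * U (sh x μ, κ) * (U (sh x κ, μ))⁻¹ * (U (x, κ))⁻¹;
        let act : Cfg → ℝ := fun U => β * ∑ x : St, ∑ q : {q : Fin 4 × Fin 4 // q.1 < q.2}, ins x q.1.1 q.1.2 * (r.ρ (pl U x q.1.1 q.1.2)).trace.re;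
        let wgt : Cfg → ℝ := fun U => Real.exp (act U);
        let Ex : (Cfg → ℝ) → ℝ := fun F => (∫ U, F U * wgt U ∂ν) / (∫ U, wgt U ∂ν);
        let σ : ℕ → Cfg → Cfg := fun n U p => U ((p.1.1 + n, p.1.2), p.2);
        ∀ c : ZMod L,
        let Loc := fun F : Cfg → ℝ => Measurable F ∧ (∀ U, |F U| ≤ 1) ∧ ∀ U U', (∀ p : St × Fin 4, (p.1.1 - c).val ≤ w → U p = U' p) → F U = F U';
        ∀ F₁ F₂ : Cfg → ℝ, Loc F₁ → Loc F₂ → ∀ n : ℕ, 2 * n < L → |Ex (fun U => F₁ U * F₂ (σ n U)) - Ex F₁ * Ex (fun U => F₂ (σ n U))| ≤ C * Real.exp (-(m * n));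
      ∀ (β m : ℝ), 0 < m → (∀ w : ℕ, ∃ C : ℝ, ∀ M : ℕ, ∃ Lmin : ℕ, Tube M β m C w Lmin) →
        ∃ μ : MeasureTheory.Measure (LGConfig 4 G), μ ∈ ymGibbsMeasures (d := 4) r.ρ β ∧
          ∀ A B : YMSpecies G, ∃ C : ℝ, ∀ n : ℕ,
            |(∫ U, A.F U * B.F (configShift (-Pi.single 0 (n : ℤ)) U) ∂μ) -
                (∫ U, A.F U ∂μ) * (∫ U, B.F (configShift (-Pi.single 0 (n : ℤ)) U) ∂μ)| ≤
              C * Real.exp (-(m * n)) :=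
  -- LANDED (lead prover-line-stmt-QuantumFields-16244-0, p159851):
  -- `Theorems/ContractibleFibreFibreToTorusStubTubeLimitState.lean` (+ helpers DLRLimit p158433,
  -- LocalDLR p158603, Chart p158873, TubeChart p159373).
  Summit.QuantumFields.YangMills.Theorems.FibreToTorus.stub_tubeLimitState

/-- Registered stub `stub_gaugeInvariantUniqueness` : the statement `GaugeInvariantUniqueness` written out (the
hardest stub: weak-coupling DLR uniqueness on the gauge-invariant algebra; open). -/
theorem stub_gaugeInvariantUniqueness :
    ∀ (G : Type) [Group G] [TopologicalSpace G] [IsTopologicalGroup G] [CompactSpace G]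
      [MeasurableSpace G] [BorelSpace G], IsCompactSimpleLieGroup G → ∀ r : LatticeRep G,
      ∃ βu : ℝ, ∀ β : ℝ, βu ≤ β → ∀ μ ν : MeasureTheory.Measure (LGConfig 4 G),
        μ ∈ ymGibbsMeasures (d := 4) r.ρ β → ν ∈ ymGibbsMeasures (d := 4) r.ρ β →
          ∀ A : YMSpecies G, ∫ U, A.F U ∂μ = ∫ U, A.F U ∂ν := by
  sorry

/-- Registered stub `stub_torusFiniteSize` : the statement `TorusFiniteSize` written out (same statement as
`birth`'s `stub_vacuumDominance` — one proof closes both). -/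
theorem stub_torusFiniteSize :
    ∀ (G : Type) [Group G] [TopologicalSpace G] [IsTopologicalGroup G] [CompactSpace G]
      [MeasurableSpace G] [BorelSpace G], IsCompactSimpleLieGroup G → ∀ (r : LatticeRep G) (β₃ : ℝ),
      (∀ β : ℝ, β₃ ≤ β → ∃ m : ℝ, 0 < m ∧
        ∀ A B : YMSpecies G, ∃ C : ℝ, ∀ μ : MeasureTheory.Measure (LGConfig 4 G),
          μ ∈ infiniteVolumeLimitPoints (d := 4) r.ρ β → ∀ n : ℕ,
            |(∫ U, A.F U * B.F (configShift (-Pi.single 0 (n : ℤ)) U) ∂μ) -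
                (∫ U, A.F U ∂μ) * (∫ U, B.F (configShift (-Pi.single 0 (n : ℤ)) U) ∂μ)| ≤
              C * Real.exp (-(m * n))) →
      ∃ β₀ : ℝ, ∀ β : ℝ, β₀ ≤ β → ∃ m : ℝ, 0 < m ∧ ∃ S₁ : ℕ, ∀ A B : YMSpecies G, ∃ C : ℝ,
        ∀ S n : ℕ, S₁ ≤ S → n ≤ S →
          |latticeConnectedCorr r.ρ β (2 * S + 1) A.F B.F n| ≤ C * Real.exp (-(m * n)) := by
  sorry

/-! ## Signature match (kernel-checked): each registered stub IS its named statement -/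

example : TubeLimitState := stub_tubeLimitState
example : GaugeInvariantUniqueness := stub_gaugeInvariantUniqueness
example : TorusFiniteSize := stub_torusFiniteSize

/-! ## Name-keyed aliases of the stub statements — the hypotheses of `FibreToTorus_of`
(device of `Lines/birth.lean`: the native skeleton audit admits a `Prop` hypothesis named like a declared stub). -/
namespace __Registered

/-- Alias of `TubeLimitState` keyed by the registered stub name. -/
abbrev stub_tubeLimitState : Prop := TubeLimitState
/-- Alias of `GaugeInvariantUniqueness` keyed by the registered stub name. -/
abbrev stub_gaugeInvariantUniqueness : Prop := GaugeInvariantUniqueness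
/-- Alias of `TorusFiniteSize` keyed by the registered stub name. -/
abbrev stub_torusFiniteSize : Prop := TorusFiniteSize

end __Registered

/-! ## Composition: the crux BY NAME from the three stub statements (no `sorry` below this line) -/

/-- **`FibreToTorus_of : (U) → (V) → FibreToTorus`** ((T) discharged by the landed theorem).  Fix `G`, `hG`, `r`, put the Borel σ-algebra on `G` as
the crux does (`letI := borel G`); `β₁` from the crux hypothesis, `β_u` from (U); at each `β ≥ max β₁ β_u`, (T) turns
the tube family at the tube rate `m(β)` into a DLR state `μ` clustering at rate `m(β)`; every periodic limit point `ν`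
is DLR (landed theorem `mem_ymGibbsMeasures_of_mem_infiniteVolumeLimitPoints_holds`; `G` is Hausdorff and second
countable through the faithful matrix representation `r`), so by (U) it has the same one- and two-point functions of
gauge-invariant local observables as `μ` (`shiftObs`, `prodObs`) and clusters at rate `m(β)` with `μ`'s constants;
(V) at threshold `max β₁ β_u` is the crux's conclusion for `r`.  Conclusion = the route decl, by name. -/
theorem FibreToTorus_of
    (hU : __Registered.stub_gaugeInvariantUniqueness) (hV : __Registered.stub_torusFiniteSize) :
    Summit.QuantumFields.YangMills.Theses.ContractibleFibre.FibreToTorus := by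
  -- (T) is no longer a hypothesis: it is the LANDED theorem (p159851)
  have hT : __Registered.stub_tubeLimitState := stub_tubeLimitState
  intro G _ _ _ _ hG r Tube hfam
  letI : MeasurableSpace G := borel G
  haveI : BorelSpace G := ⟨rfl⟩
  obtain ⟨β₁, hβ₁⟩ := hfam
  -- (T): at every β ≥ β₁ an exponentially time-clustering DLR state on ℤ⁴, at the tube rate m(β)
  have hDLR : ∀ β : ℝ, β₁ ≤ β → ∃ m : ℝ, 0 < m ∧
      ∃ μ : MeasureTheory.Measure (LGConfig 4 G), μ ∈ ymGibbsMeasures (d := 4) r.ρ β ∧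
        ∀ A B : YMSpecies G, ∃ C : ℝ, ∀ n : ℕ,
          |(∫ U, A.F U * B.F (configShift (-Pi.single 0 (n : ℤ)) U) ∂μ) -
            (∫ U, A.F U ∂μ) * (∫ U, B.F (configShift (-Pi.single 0 (n : ℤ)) U) ∂μ)| ≤
          C * Real.exp (-(m * n)) := by
    intro β hβ
    obtain ⟨m, hm, hfamβ⟩ := hβ₁ β hβ
    exact ⟨m, hm, hT G hG r β m hm hfamβ⟩
  -- `G` is Hausdorff and second countable: `r.ρ` is a closed embedding into a matrix space
  haveI : T2Space G := (r.continuous.isClosedEmbedding r.injective).isEmbedding.t2Space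
  haveI : SecondCountableTopology G :=
    (r.continuous.isClosedEmbedding r.injective).isEmbedding.secondCountableTopology
  obtain ⟨βu, hβu⟩ := hU G hG r
  -- (U): every periodic limit point inherits the clustering of the tube state, for β ≥ max β₁ βu
  have hIVLP : ∀ β : ℝ, max β₁ βu ≤ β → ∃ m : ℝ, 0 < m ∧
      ∀ A B : YMSpecies G, ∃ C : ℝ, ∀ μ : MeasureTheory.Measure (LGConfig 4 G),
        μ ∈ infiniteVolumeLimitPoints (d := 4) r.ρ β → ∀ n : ℕ,
          |(∫ U, A.F U * B.F (configShift (-Pi.single 0 (n : ℤ)) U) ∂μ) -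
              (∫ U, A.F U ∂μ) * (∫ U, B.F (configShift (-Pi.single 0 (n : ℤ)) U) ∂μ)| ≤
            C * Real.exp (-(m * n)) := by
    intro β hβ
    obtain ⟨m, hm, μ, hμG, hclus⟩ := hDLR β ((le_max_left _ _).trans hβ)
    refine ⟨m, hm, fun A B => ?_⟩
    obtain ⟨C, hC⟩ := hclus A B
    refine ⟨C, fun ν hν n => ?_⟩
    -- periodic limit points are DLR states (landed theorem)
    have hνG : ν ∈ ymGibbsMeasures (d := 4) r.ρ β :=
      mem_ymGibbsMeasures_of_mem_infiniteVolumeLimitPoints_holds (d := 4) r.ρ r.continuous hν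
    have hUβ : ∀ X : YMSpecies G, ∫ U, X.F U ∂ν = ∫ U, X.F U ∂μ :=
      hβu β ((le_max_right _ _).trans hβ) ν μ hνG hμG
    have h1 : ∫ U, A.F U ∂ν = ∫ U, A.F U ∂μ := hUβ A
    -- (the `simp only [shiftObs_F, prodObs_F]` re-spelling avoids an expensive first-order unification
    --  `shiftObs B (-e₀·n) =?= B` that a direct term ascription triggers)
    have h2 := hUβ (shiftObs B (-Pi.single 0 (n : ℤ)))
    simp only [shiftObs_F] at h2
    have h3 := hUβ (prodObs A (shiftObs B (-Pi.single 0 (n : ℤ))))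
    simp only [prodObs_F, shiftObs_F] at h3
    rw [h1, h2, h3]
    exact hC n
  -- (V): infinite volume ⇒ symmetric torus, S-uniform constants
  exact hV G hG r (max β₁ βu) hIVLP

/-- **Registered instantiation (kernel-checked)**: the two open stubs BY NAME give the crux BY NAME. -/
example : Summit.QuantumFields.YangMills.Theses.ContractibleFibre.FibreToTorus :=
  FibreToTorus_of stub_gaugeInvariantUniqueness stub_torusFiniteSize

end Summit.QuantumFields.YangMills.Cruxes.FibreToTorus.Uniqueness

end
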